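import Literature.Computability.MetaComplexity.ClockedUniversalRun
import Literature.Computability.Complexity.CircuitEval
import Literature.Computability.Complexity.StringEquality
import HarnessLib

/-!
# Buss's `CircEval(C, x, y)`: "the circuit coded by `C` on the input coded by `x` outputs `y`", `Δᵇ₁` in `S₂¹`

Topic `Literature/Computability/MetaComplexity`; definition request `defn-bussCircuitEval` (route
`PneNP/RootDecompAdviceProvability`, items `stmt-PneNP-28070/28071/28072`): the arithmetised
Boolean-circuit evaluation of bounded arithmetic — Krajíček–Oliveira's "`CircuitVal(y, x)`, the
polynomial time algorithm evaluating circuit `y` on input `x`" [KrajicekOliveira2016, §2 (p. 5)],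
a `PV`-function symbol, i.e. (Buss 1986, Ch. 3; Krajíček 1995, Lemma 6.1.1) a function with a
`Σᵇ₁` graph, provably total in `S₂¹` — written as ONE bounded formula `CircEval(x₀, x₁, x₂)` of the
tree's language `FirstOrder.Language.boundedArith` in the three free variables
`x₀ = C` (circuit code), `x₁ = x` (input), `x₂ = y` (output), with its `Πᵇ₁` twin, the
`S₂¹`-equivalence of the two (`Δᵇ₁`), the basic clauses (totality with the bounding term,
uniqueness of the output) holding in every model of `S₂¹`, and its meaning in `ℕ`.

## What is defined

* **The meaning in `ℕ`** (`BussCircVal c x : Bool`): the strings `numStr x` (input bits) and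
  `numStr c` (circuit description) — numbers name strings by the "`1w`" bijection `numStr`/`strNum`
  of `ClockedUniversalRun.lean`, the coding shared by the route's definitions — are fed, as the
  pair `⟨numStr x, numStr c⟩` (`boolPair`), to the tree's circuit evaluator `CircEval.evalFn ∈ FP`
  (`Literature/Computability/Complexity/CircuitEval.lean`: the value-stack machine reading the
  description `CircEval.desc C` of a `B₂`-circuit, Arora–Barak 2009, proof of Thm. 6.18), whose
  one-bit answer is the value.  On genuine codes it IS circuit evaluation:
  `BussCircVal (strNum (desc C)) (strNum (List.ofFn w)) = C.eval w` for every circuit `C` on `Fin n`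
  of fan-in `≤ 2` and every input `w : Fin n → Bool` (`bussCircVal_strNum_desc`, from
  `CircEval.evalFn_boolPair_desc`); off codes it is the (total, well-defined) junk answer of the
  machine.
* **Its characteristic function is polynomial time** (`polyTime_circChar`): the string function
  `circStrF = evalFn ∘ ⟨numStrF ∘ highF, numStrF ∘ lowF⟩` on the numeral of the pairing
  `pairVal c x` (bricks `ClockedRun.lowF/highF/numStrF`, `fanoutFn`), in `FP` by composition.
* **The uniform `Σᵇ₁` definition** `circG : GDef 2` of the output as a function of `(C, x)`:
  `GDef.ofPolyTime polyTime_circChar` (the tree's `S2Machine.machineG` — every polynomial-time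
  function is `Σᵇ₁`-definable in `S₂¹`, Buss 1986, Ch. 3 / Krajíček 1995, Lemma 6.1.1) at the
  pairing TERM `pairTm x₀ x₁`; good in every model of `S₂¹` (`good_circG`: graph `Σᵇ₁`, total,
  functional, below its bounding term), with value `[C(x)] ∈ {0, 1}` in `ℕ` (`fn_circG`).
* For ANY uniform definition `G : GDef n`, the two forms of the open formula "`y = G(x̄)`" in the
  `n + 1` free variables `(x̄, y)` (Buss 1986, §2.2, Thm. 2.2: atomic formulas in `Σᵇ₁`-defined
  function symbols are `Δᵇ₁` in `S₂¹`): the `Σᵇ₁` form is the graph `G.graph` itself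
  (`GDef.realize_graph_iff`), the `Πᵇ₁` form is
  `GDef.graphPi G = ∀ y' ≤ t_G(x̄) (φ_G(x̄, y') → y' = y)` (`GDef.isPi_graphPi`,
  `GDef.realize_graphPi`); they agree wherever `G` is total and functional, hence
  `S₂¹ ⊨ᵇ φ_G ⇔ graphPi G` for good `G` (`GDef.models_graph_iff_graphPi`); and the two basic
  clauses `S₂¹ ⊨ᵇ ∃ y ≤ t_G(x̄) φ_G(x̄, y)` (`GDef.models_total`) and
  `S₂¹ ⊨ᵇ φ_G(x̄, y) ∧ φ_G(x̄, y') → y = y'` (`GDef.uniqForm`, `GDef.models_unique`).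
* **`bussCircuitEval : Language.boundedArith.Formula (Fin 3)`** — THE requested formula
  `CircEval(x₀, x₁, x₂) = φ_circ(x₀, x₁, x₂)`, the `Σᵇ₁` graph of `circG` (`isSigmab_bussCircuitEval`);
  its `Πᵇ₁` form `bussCircuitEvalPi` (`isPib_bussCircuitEvalPi`); **`Δᵇ₁` with respect to `S₂¹`**:
  `bussCircuitEval_iff_pi : S2 1 ⊨ᵇ bussCircuitEval ⇔ bussCircuitEvalPi`; the **basic clauses**
  `bussCircuitEval_total : S2 1 ⊨ᵇ ∃ x₂ ≤ t(x₀, x₁) CircEval(x₀, x₁, x₂)` (totality, with the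
  polynomial size bound on the output AS A TERM `t = circG.bound`) and
  `bussCircuitEval_unique : S2 1 ⊨ᵇ CircEval(x₀, x₁, x₂) ∧ CircEval(x₀, x₁, x₃) → x₂ = x₃`; and the
  **agreement in the standard model** `realize_bussCircuitEval : CircEval(c, x, y) ↔ y = [C(x)]`,
  on genuine codes `realize_bussCircuitEval_strNum_desc`.

## Not formalised here

The gate-by-gate recursion of the evaluator as an `S₂¹`-THEOREM about `bussCircuitEval` (the value
of a code obtained by appending one gate) is a statement about the internal coding of
`CircEval.desc` inside models of `S₂¹`; it is not needed to WRITE the sentences "`NP ⊆ SIZE[nᵏ]`" /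
"`NP ⊆ P/poly`" of the consumers and is left to the consumer that needs it.  No named fact is
introduced by this file.

## Conventions

"`x` is an `n`-bit input" reads `|x| = n + 1` on numbers (`numStr`); a circuit on `n` inputs is
named by the number `strNum (CircEval.desc C)` of its machine description; the output variable
ranges over `{0, 1}` on codes (`realize_bussCircuitEval`: `y = 1` if the value is `true`, `y = 0`
otherwise), so "`C(x) = 1`" of [KrajicekOliveira2016, §2, (1)] is `CircEval(C, x, 1)`.

## References

* J. Krajíček, I. C. Oliveira, *Unprovability of circuit upper bounds in Cook's theory PV*,
  Log. Methods Comput. Sci. 13(1:4) (2017), arXiv:1605.00263, §2 (p. 5: `CircuitVal(y, x)`),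
  §1 (1) (the sentence `∀1⁽ⁿ⁾ ∃ C_n (|C_n| ≤ c nᵏ) ∀ x (|x| = n), f(x) ≠ 0 ↔ C_n(x) = 1`).
* S. R. Buss, *Bounded Arithmetic*, Bibliopolis 1986, §2.2 (Thm. 2.2: `Δᵇ₁` atomic formulas of
  `Σᵇ₁`-defined functions), Ch. 3 (polynomial-time functions are `Σᵇ₁`-definable in `S₂¹`).
* J. Krajíček, *Bounded Arithmetic, Propositional Logic and Complexity Theory*, CUP 1995, §5.2,
  Lemma 6.1.1 (p. 86).
* S. Arora, B. Barak, *Computational Complexity: A Modern Approach*, CUP 2009, Thm. 6.18 (proof: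
  circuit evaluation in `P`), §1.3.
-/

noncomputable section

namespace Literature.Computability.MetaComplexity

open FirstOrder FirstOrder.Language
open _root_.Computability
open Literature.Computability.Complexity

/-! ## The predicate in the standard model -/

/-- **The value of the circuit named by `c` on the input named by `x`**: the one-bit answer of the
tree's circuit evaluator `CircEval.evalFn` on the pair `⟨numStr x, numStr c⟩` (input string,
circuit description).  On genuine codes this is `C.eval` (`bussCircVal_strNum_desc`).
[cite: KrajicekOliveira2016, §2 (p. 5)] -/
def BussCircVal (c x : ℕ) : Bool :=
  (CircEval.evalFn (boolPair (numStr x) (numStr c))).headD false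

/-- The evaluator's answer is the single bit `BussCircVal c x` (`CircEval.evalFn_eq_or`: the machine
outputs one bit). [cite: AroraBarak2009, Thm. 6.18 (proof)] -/
theorem evalFn_boolPair_numStr (c x : ℕ) :
    CircEval.evalFn (boolPair (numStr x) (numStr c)) = [BussCircVal c x] := by
  unfold BussCircVal
  rcases CircEval.evalFn_eq_or (boolPair (numStr x) (numStr c)) with h | h <;> simp [h]

/-- The circuit evaluator on `⟨w, desc C⟩` for a circuit `C` on `Fin n` of fan-in `≤ 2` and a word
`w` of length `n` (transport of `CircEval.evalFn_boolPair_desc` along `|w| = n`).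
[cite: AroraBarak2009, Thm. 6.18 (proof)] -/
theorem evalFn_boolPair_desc_of_length {n : ℕ} (w : List Bool) (h : w.length = n)
    (C : Circuit (Fin n)) (hC : ∀ g ∈ C.gates, g.arity ≤ 2) :
    CircEval.evalFn (boolPair w (CircEval.desc C)) = [C.eval fun i => w.get (Fin.cast h.symm i)] := by
  subst h
  rw [CircEval.evalFn_boolPair_desc w C hC]
  rfl

/-- **On genuine codes `BussCircVal` is circuit evaluation**: for a circuit `C` on `Fin n` of
fan-in `≤ 2` and an input `w : Fin n → Bool`,
`BussCircVal (strNum (desc C)) (strNum (List.ofFn w)) = C.eval w`.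
[cite: AroraBarak2009, Thm. 6.18 (proof)] -/
theorem bussCircVal_strNum_desc {n : ℕ} (C : Circuit (Fin n)) (hC : ∀ g ∈ C.gates, g.arity ≤ 2)
    (w : Fin n → Bool) :
    BussCircVal (strNum (CircEval.desc C)) (strNum (List.ofFn w)) = C.eval w := by
  unfold BussCircVal
  rw [numStr_strNum, numStr_strNum,
    evalFn_boolPair_desc_of_length (List.ofFn w) (List.length_ofFn) C hC]
  simp only [List.headD_cons]
  congr 1
  funext i
  simp

/-! ## The characteristic function is polynomial time -/

namespace BussCircFn

/-- **The characteristic string function** of circuit evaluation on the numeral of `pairVal c x`: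
split the pairing (`ClockedRun.lowF` = `c` padded, `ClockedRun.highF` = `x` padded), name the two
strings (`ClockedRun.numStrF`), pair them as `⟨numStr x, numStr c⟩` (`fanoutFn`) and run the
evaluator (`CircEval.evalFn`). [cite: AroraBarak2009, Thm. 6.18 (proof)] -/
def circStrF : List Bool → List Bool :=
  CircEval.evalFn ∘
    fanoutFn (ClockedRun.numStrF ∘ ClockedRun.highF) (ClockedRun.numStrF ∘ ClockedRun.lowF)

/-- `circStrF ∈ FP`. [cite: AroraBarak2009, Thm. 6.18 (proof)] -/
theorem circStrF_mem_FP : circStrF ∈ FP :=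
  comp_mem_FP CircEval.evalFn_mem_FP
    (fanoutFn_mem_FP (comp_mem_FP ClockedRun.numStrF_mem_FP ClockedRun.highF_mem_FP)
      (comp_mem_FP ClockedRun.numStrF_mem_FP ClockedRun.lowF_mem_FP))

/-- **Value of `circStrF` on a pair**: `[C(x)]`. [cite: AroraBarak2009, Thm. 6.18 (proof)] -/
theorem circStrF_encodeNat_pairVal (c x : ℕ) :
    circStrF (encodeNat (pairVal c x)) = [BussCircVal c x] := by
  rw [circStrF, Function.comp_apply, fanoutFn_apply, Function.comp_apply, Function.comp_apply,
    ClockedRun.highF_encodeNat_pairVal, ClockedRun.lowF_encodeNat_pairVal,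
    ClockedRun.numStrF_padTo_encodeNat, ClockedRun.numStrF_padTo_encodeNat, evalFn_boolPair_numStr]

end BussCircFn

/-- **The characteristic function of circuit evaluation** as a function of one number:
`circChar (pairVal c x) = [C(x)]` (`circChar_pairVal`; junk, but well defined, off pairs).
[folklore] -/
def circChar (p : ℕ) : ℕ :=
  bitsToNat (BussCircFn.circStrF (encodeNat p))

/-- Value of `circChar` on a pair: `[C(x)]`. [cite: AroraBarak2009, Thm. 6.18 (proof)] -/
theorem circChar_pairVal (c x : ℕ) :
    circChar (pairVal c x) = if BussCircVal c x then 1 else 0 := by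
  rw [circChar, BussCircFn.circStrF_encodeNat_pairVal]
  cases BussCircVal c x <;> simp

/-- **The characteristic function of circuit evaluation is polynomial time** on binary numerals
(`BussCircFn.circStrF_mem_FP`, output normalised by `norm`). [cite: AroraBarak2009, Thm. 6.18 (proof)] -/
theorem polyTime_circChar : PolyTimeComputable encodeNat encodeNat circChar :=
  PolyTimeComputable.of_encode (F := norm ∘ BussCircFn.circStrF) (ea' := id) (eb' := id)
    (comp_mem_FP Brick.norm_mem_FP BussCircFn.circStrF_mem_FP) encodeNat (fun _ => rfl)
    fun _ => (id_eq _).trans ((Function.comp_apply).trans (norm_eq_encodeNat _))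

/-! ## "`y = G(x̄)`" in its two forms and the basic clauses, for any uniform definition `G` -/

namespace GDef

variable {n : ℕ}

/-- **`y = G(x̄)`, `Πᵇ₁` form**, an open formula in the `n + 1` variables `(x̄, y)`:
`∀ y' ≤ t_G(x̄) (φ_G(x̄, y') → y' = y)` (Buss 1986, §2.2, Thm. 2.2: atomic formulas in
`Σᵇ₁`-defined function symbols are `Δᵇ₁` in `S₂¹`; the `Σᵇ₁` form is the graph `φ_G(x̄, y)`
itself). [cite: Buss1986, §2.2, Thm. 2.2] -/
def graphPi (G : GDef n) : SForm (n + 1) :=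
  SForm.ball (G.bound.relabel Fin.castSucc)
    (SForm.imp (SForm.rel (SForm.liftLast Fin.castSucc) G.graph)
      (SForm.eq (Term.var (Fin.last (n + 1))) (Term.var (Fin.castSucc (Fin.last n)))))

/-- **Uniqueness clause** as an open formula in the `n + 2` variables `(x̄, y, y')`:
`φ_G(x̄, y) ∧ φ_G(x̄, y') → y = y'`. [cite: Buss1986, §2.2] -/
def uniqForm (G : GDef n) : SForm (n + 2) :=
  SForm.imp
    (SForm.and (SForm.rel Fin.castSucc G.graph) (SForm.rel (SForm.liftLast Fin.castSucc) G.graph))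
    (SForm.eq (Term.var (Fin.castSucc (Fin.last n))) (Term.var (Fin.last (n + 1))))

/-- The `Πᵇ₁` form is syntactically `Πᵇ₁` when the graph is `Σᵇ₁`. [cite: Buss1986, §2.1] -/
theorem isPi_graphPi {G : GDef n} (h : G.graph.IsSig) : (graphPi G).IsPi := by
  simp_all [SForm.IsSig, SForm.IsPi, graphPi, SForm.cls]

section Models

variable {M : Type} [Language.boundedArith.Structure M] {G : GDef n}

omit [Language.boundedArith.Structure M] in
/-- An assignment of `n + 1` variables is `snoc` of its initial part and its last value. [folklore] -/
private theorem snoc_init_last (v : Fin (n + 1) → M) : Fin.snoc (Fin.init v) (v (Fin.last n)) = v :=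
  Fin.snoc_init_self v

omit [Language.boundedArith.Structure M] in
/-- An assignment of `n + 2` variables composed with `castSucc` is `snoc` of the first `n` values and
the `(n+1)`-st. [folklore] -/
private theorem comp_castSucc_eq_snoc (v : Fin (n + 2) → M) :
    (v ∘ Fin.castSucc : Fin (n + 1) → M) =
      Fin.snoc (Fin.init (Fin.init v)) (v (Fin.castSucc (Fin.last n))) := by
  funext j
  cases j using Fin.lastCases with
  | last => simp
  | cast j => simp [Fin.init]

omit [Language.boundedArith.Structure M] in
/-- An assignment of `n + 2` variables composed with `liftLast castSucc` is `snoc` of the first `n`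
values and the last. [folklore] -/
private theorem comp_liftLast_castSucc_eq_snoc (v : Fin (n + 2) → M) :
    (v ∘ SForm.liftLast Fin.castSucc : Fin (n + 1) → M) =
      Fin.snoc (Fin.init (Fin.init v)) (v (Fin.last (n + 1))) := by
  funext j
  cases j using Fin.lastCases with
  | last => simp [SForm.liftLast]
  | cast j => simp [SForm.liftLast, Fin.init]

/-- **Semantics of the graph as an open formula in `(x̄, y)`**: in a structure in which `G` is
total and functional, `φ_G` holds of `v` iff the last value is `G.fn` of the others.
[cite: Buss1986, §2.2, Thm. 2.2] -/
theorem realize_graph_iff (hG : G.IsFnIn M) (v : Fin (n + 1) → M) :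
    G.graph.Realize v ↔ v (Fin.last n) = G.fn (Fin.init v) := by
  rw [← hG.rel_iff, Rel, snoc_init_last]

/-- **Semantics of the `Πᵇ₁` form**: the same. [cite: Buss1986, §2.2, Thm. 2.2] -/
theorem realize_graphPi (hG : G.IsFnIn M) (v : Fin (n + 1) → M) :
    (graphPi G).Realize v ↔ v (Fin.last n) = G.fn (Fin.init v) := by
  have hb : (G.bound.relabel Fin.castSucc : Language.boundedArith.Term (Fin (n + 1))).realize v =
      G.bound.realize (Fin.init v) := by
    rw [Term.realize_relabel]; rfl
  have hg : ∀ a : M, (SForm.rel (SForm.liftLast Fin.castSucc) G.graph).Realize (Fin.snoc v a) ↔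
      G.Rel (Fin.init v) a := by
    intro a
    rw [SForm.realize_rel, comp_liftLast_castSucc_eq_snoc, Fin.init_snoc, Fin.snoc_last]
    rfl
  simp only [graphPi, SForm.realize_ball, SForm.realize_imp, SForm.realize_eq, Term.realize_var,
    Fin.snoc_last, Fin.snoc_castSucc, hb, hg]
  constructor
  · intro h
    exact (h (G.fn (Fin.init v)) (hG.fn_le _) (hG.rel_fn _)).symm
  · intro h a _ hrel
    rw [h]
    exact (hG.fn_eq_of_rel hrel).symm

/-- **The two forms agree** wherever `G` is total and functional. [cite: Buss1986, §2.2, Thm. 2.2] -/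
theorem realize_graph_iff_graphPi (hG : G.IsFnIn M) (v : Fin (n + 1) → M) :
    G.graph.Realize v ↔ (graphPi G).Realize v := by
  rw [realize_graph_iff hG, realize_graphPi hG]

/-- **Semantics of the uniqueness clause**: it holds wherever `G` is functional. [cite: Buss1986, §2.2] -/
theorem realize_uniqForm (hG : G.IsFnIn M) (v : Fin (n + 2) → M) : (uniqForm G).Realize v := by
  simp only [uniqForm, SForm.realize_imp, SForm.realize_and, SForm.realize_eq, SForm.realize_rel,
    Term.realize_var, comp_castSucc_eq_snoc, comp_liftLast_castSucc_eq_snoc]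
  rintro ⟨h1, h2⟩
  exact hG.unique _ _ _ h1 h2

/-- **Semantics of the totality clause** `∃ y ≤ t_G(x̄) φ_G(x̄, y)`: it holds wherever `G` is total
and bounded by its term. [cite: Buss1986, §2.2] -/
theorem realize_bex_graph (hG : G.IsFnIn M) (v : Fin n → M) :
    (SForm.bex G.bound G.graph).Realize v :=
  (SForm.realize_bex _ _ _).2 ⟨G.fn v, hG.fn_le v, hG.rel_fn v⟩

end Models

/-- **`S₂¹` proves the two forms equivalent** (semantically, Mathlib's `⊨ᵇ`): for a good `G`,
`φ_G(x̄, y) ⇔ graphPi G (x̄, y)` holds in every model of `S₂¹` under every assignment — the open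
formula "`y = G(x̄)`" is `Δᵇ₁` with respect to `S₂¹`. [cite: Buss1986, §2.2, Thm. 2.2] -/
theorem models_graph_iff_graphPi {G : GDef n} (hG : G.Good) :
    S2 1 ⊨ᵇ (G.graph.toFormula ⇔ (graphPi G).toFormula) := by
  intro M v xs
  haveI : (M : Type) ⊨ BASIC := (Theory.model_union_iff.1 M.is_model).1
  haveI : (M : Type) ⊨ PINDScheme (sigmabFormulas 1) := (Theory.model_union_iff.1 M.is_model).2
  rw [BoundedFormula.realize_iff]
  have h1 := SForm.realize_toFormula G.graph v
  have h2 := SForm.realize_toFormula (graphPi G) v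
  rw [Formula.Realize] at h1 h2
  rw [Unique.eq_default xs, h1, h2]
  exact realize_graph_iff_graphPi (hG.isFn M) v

/-- **`S₂¹` proves totality with the bounding term**: `S₂¹ ⊨ᵇ ∃ y ≤ t_G(x̄) φ_G(x̄, y)` for a good
`G` (Buss 1986, §2.2: the defining condition `S₂¹ ⊢ ∀x̄ ∃y ≤ t φ` of a `Σᵇ₁`-defined function).
[cite: Buss1986, §2.2] -/
theorem models_total {G : GDef n} (hG : G.Good) : S2 1 ⊨ᵇ (SForm.bex G.bound G.graph).toFormula := by
  intro M v xs
  haveI : (M : Type) ⊨ BASIC := (Theory.model_union_iff.1 M.is_model).1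
  haveI : (M : Type) ⊨ PINDScheme (sigmabFormulas 1) := (Theory.model_union_iff.1 M.is_model).2
  have h := SForm.realize_toFormula (SForm.bex G.bound G.graph) v
  rw [Formula.Realize] at h
  rw [Unique.eq_default xs, h]
  exact realize_bex_graph (hG.isFn M) v

/-- **`S₂¹` proves uniqueness of the value**: `S₂¹ ⊨ᵇ φ_G(x̄, y) ∧ φ_G(x̄, y') → y = y'` for a good
`G`. [cite: Buss1986, §2.2] -/
theorem models_unique {G : GDef n} (hG : G.Good) : S2 1 ⊨ᵇ (uniqForm G).toFormula := by
  intro M v xs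
  haveI : (M : Type) ⊨ BASIC := (Theory.model_union_iff.1 M.is_model).1
  haveI : (M : Type) ⊨ PINDScheme (sigmabFormulas 1) := (Theory.model_union_iff.1 M.is_model).2
  have h := SForm.realize_toFormula (uniqForm G) v
  rw [Formula.Realize] at h
  rw [Unique.eq_default xs, h]
  exact realize_uniqForm (hG.isFn M) v

end GDef

/-! ## The uniform definition of the circuit value and the formula `CircEval` -/

/-- **The uniform `Σᵇ₁` definition of the circuit value** as a function of `(C, x) = (x₀, x₁)`:
`GDef.ofPolyTime polyTime_circChar` at the pairing term `pairTm x₀ x₁` — the `PV`-function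
`CircuitVal` of [KrajicekOliveira2016, §2] as a `Σᵇ₁`-defined function of `S₂¹`.
[cite: Krajicek1995, Lemma 6.1.1 (p. 86)] -/
def circG : GDef 2 :=
  GDef.substArgs ![pairTm (Term.var 0) (Term.var 1)] (GDef.ofPolyTime polyTime_circChar)

/-- `circG` is good (graph `Σᵇ₁`, total, functional and term-bounded in every model of `S₂¹`).
[cite: Krajicek1995, Lemma 6.1.1 (p. 86)] -/
theorem good_circG : circG.Good :=
  (GDef.good_ofPolyTime _).substArgs _

/-- **Value of `circG` in `ℕ`**: `[C(x)] ∈ {0, 1}`. [cite: Krajicek1995, Lemma 6.1.1 (p. 86)] -/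
theorem fn_circG (c x : ℕ) : circG.fn ![c, x] = if BussCircVal c x then 1 else 0 := by
  haveI : ℕ ⊨ BASIC := model_nat_BASIC_holds
  haveI : ℕ ⊨ PINDScheme (sigmabFormulas 1) := model_nat_PINDScheme _
  rw [circG, GDef.fn_substArgs (GDef.good_ofPolyTime _)]
  have h : (fun j : Fin 1 =>
      ((![pairTm (Term.var 0) (Term.var 1)] : Fin 1 → Language.boundedArith.Term (Fin 2)) j).realize
        ![c, x]) = ![pairVal c x] := by
    funext j
    fin_cases j
    simp
  rw [h, GDef.fn_ofPolyTime, circChar_pairVal]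

/-- **`CircEval(x₀, x₁, x₂)` — Buss-style bounded formula "the circuit coded by `x₀` on the input
coded by `x₁` outputs `x₂`", `Σᵇ₁` form** (the definition requested as `bussCircuitEval`): the
`Σᵇ₁` graph `φ_circ(x₀, x₁, x₂)` of the uniform definition `circG` of the circuit value, an open
formula in three free variables.  `Δᵇ₁` with respect to `S₂¹` (`bussCircuitEval_iff_pi`), provably
total and functional in `S₂¹` (`bussCircuitEval_total`, `bussCircuitEval_unique`), and in `ℕ` it
says `x₂ = [value of the circuit numStr x₀ on the input numStr x₁]` (`realize_bussCircuitEval`).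
[cite: KrajicekOliveira2016, §2 (p. 5)] -/
def bussCircuitEval : Language.boundedArith.Formula (Fin 3) :=
  circG.graph.toFormula

/-- **`CircEval(x₀, x₁, x₂)`, `Πᵇ₁` form**: `∀ y ≤ t(x₀, x₁) (φ_circ(x₀, x₁, y) → y = x₂)`.
[cite: Buss1986, §2.2, Thm. 2.2] -/
def bussCircuitEvalPi : Language.boundedArith.Formula (Fin 3) :=
  (GDef.graphPi circG).toFormula

/-- `bussCircuitEval` is a `Σᵇ₁` formula. [cite: Buss1986, §2.1] -/
theorem isSigmab_bussCircuitEval : IsSigmab 1 bussCircuitEval :=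
  SForm.isSigmab_toFormula good_circG.sig

/-- `bussCircuitEvalPi` is a `Πᵇ₁` formula. [cite: Buss1986, §2.1] -/
theorem isPib_bussCircuitEvalPi : IsPib 1 bussCircuitEvalPi :=
  SForm.isPib_toFormula (GDef.isPi_graphPi good_circG.sig)

/-- **`CircEval` is `Δᵇ₁` with respect to `S₂¹`**: `S₂¹ ⊨ᵇ CircEval_Σ(x₀, x₁, x₂) ⇔ CircEval_Π(x₀, x₁, x₂)`.
[cite: Buss1986, §2.2, Thm. 2.2] -/
theorem bussCircuitEval_iff_pi : S2 1 ⊨ᵇ (bussCircuitEval ⇔ bussCircuitEvalPi) :=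
  GDef.models_graph_iff_graphPi good_circG

/-- **Basic clause: totality with the size bound as a term** — `S₂¹ ⊨ᵇ ∃ x₂ ≤ t(x₀, x₁) CircEval(x₀, x₁, x₂)`
with `t = circG.bound`, a term of Buss's language. [cite: Buss1986, §2.2] -/
theorem bussCircuitEval_total : S2 1 ⊨ᵇ (SForm.bex circG.bound circG.graph).toFormula :=
  GDef.models_total good_circG

/-- **Basic clause: uniqueness of the output** —
`S₂¹ ⊨ᵇ CircEval(x₀, x₁, x₂) ∧ CircEval(x₀, x₁, x₃) → x₂ = x₃`. [cite: Buss1986, §2.2] -/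
theorem bussCircuitEval_unique : S2 1 ⊨ᵇ (GDef.uniqForm circG).toFormula :=
  GDef.models_unique good_circG

/-- The initial part of a three-variable assignment. [folklore] -/
private theorem init_vec3 (c x y : ℕ) : Fin.init (![c, x, y] : Fin 3 → ℕ) = ![c, x] := by
  funext j
  fin_cases j <;> rfl

/-- **Agreement in the standard model**: `ℕ ⊨ CircEval(c, x, y) ↔ y = [BussCircVal c x]`
(`1` if the circuit named by `c` accepts the input named by `x`, else `0`).
[cite: KrajicekOliveira2016, §2 (p. 5)] -/
theorem realize_bussCircuitEval (c x y : ℕ) :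
    bussCircuitEval.Realize ![c, x, y] ↔ y = if BussCircVal c x then 1 else 0 := by
  haveI : ℕ ⊨ BASIC := model_nat_BASIC_holds
  haveI : ℕ ⊨ PINDScheme (sigmabFormulas 1) := model_nat_PINDScheme _
  rw [bussCircuitEval, SForm.realize_toFormula, GDef.realize_graph_iff (good_circG.isFn ℕ), init_vec3,
    fn_circG]
  rfl

/-- The `Πᵇ₁` form agrees as well. [cite: Buss1986, §2.2, Thm. 2.2] -/
theorem realize_bussCircuitEvalPi (c x y : ℕ) :
    bussCircuitEvalPi.Realize ![c, x, y] ↔ y = if BussCircVal c x then 1 else 0 := by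
  haveI : ℕ ⊨ BASIC := model_nat_BASIC_holds
  haveI : ℕ ⊨ PINDScheme (sigmabFormulas 1) := model_nat_PINDScheme _
  rw [bussCircuitEvalPi, SForm.realize_toFormula, GDef.realize_graphPi (good_circG.isFn ℕ), init_vec3,
    fn_circG]
  rfl

/-- "`C(x) = 1`": `ℕ ⊨ CircEval(c, x, 1)` iff the value is `true`. [cite: KrajicekOliveira2016, §1, (1)] -/
theorem realize_bussCircuitEval_one_iff (c x : ℕ) :
    bussCircuitEval.Realize ![c, x, 1] ↔ BussCircVal c x = true := by
  rw [realize_bussCircuitEval]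
  cases BussCircVal c x <;> simp

/-- **Agreement on genuine codes**: for a circuit `C` on `Fin n` of fan-in `≤ 2` and an input
`w : Fin n → Bool`, `ℕ ⊨ CircEval(strNum (desc C), strNum (List.ofFn w), y)` iff `y = [C.eval w]`.
[cite: AroraBarak2009, Thm. 6.18 (proof)] -/
theorem realize_bussCircuitEval_strNum_desc {n : ℕ} (C : Circuit (Fin n))
    (hC : ∀ g ∈ C.gates, g.arity ≤ 2) (w : Fin n → Bool) (y : ℕ) :
    bussCircuitEval.Realize ![strNum (CircEval.desc C), strNum (List.ofFn w), y] ↔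
      y = if C.eval w then 1 else 0 := by
  rw [realize_bussCircuitEval, bussCircVal_strNum_desc C hC w]

/-- On genuine codes, "`C(x) = 1`" is acceptance: `ℕ ⊨ CircEval(strNum (desc C), strNum (ofFn w), 1)`
iff `C.eval w = true`. [cite: KrajicekOliveira2016, §1, (1)] -/
theorem realize_bussCircuitEval_strNum_desc_one_iff {n : ℕ} (C : Circuit (Fin n))
    (hC : ∀ g ∈ C.gates, g.arity ≤ 2) (w : Fin n → Bool) :
    bussCircuitEval.Realize ![strNum (CircEval.desc C), strNum (List.ofFn w), 1] ↔ C.eval w = true := by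
  rw [realize_bussCircuitEval_one_iff, bussCircVal_strNum_desc C hC w]

end Literature.Computability.MetaComplexity

end
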